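import Summits.ABC.ABC.Theses.IsogenyGlueCongruence

/-!
# `DegreePrimesPolyBounded` (stmt-ABC-2045): pumping the Manin constant; the `∀ D` form is false

Negative support lemmas for the crux `Summit.ABC.ABC.Theses.IsogenyGlueCongruence.DegreePrimesPolyBounded`
(cdisprove seat, cycle 1). The crux quantifies `∃ D : ModularParametrizationData W N`; this file shows the
`∃` is essential. From a datum `D` and `k ≥ 1` we BUILD the datum `pump D k` with the same newform, lattice and
uniformisation, Manin constant `k · c` and degree `k² · deg` (`φ' = [k] ∘ φ`); its field `deg_spec` is proved from
the fields of `D` (the `k`-division points of `E(ℂ) ≅ ℂ/Λ` through `uniformize`: exactly `k²` translates,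
`div_mem_lattice_iff`; fibre decomposition `setOf_fibre_smul_eq`; disjointness from the `Γ₀(N)`-invariance
`D.φ_gamma0_smul`, which holds by `φ_gamma0_smul_holds` given the C9 fact `eichlerIntegral_gamma_smul D.f`).
Consequences: `not_forall_datum_primes_bounded_of` — "EVERY datum of every semistable minimal curve has prime
factors `≤ C N^κ`" is false as soon as one such curve carries one invariant datum (pump by a prime `p > C N^κ`);
`not_forall_datum_primes_bounded_of_facts` — the same over the named facts `nonempty_modularParametrizationData`
and `eichlerIntegral_gamma_smul` plus the existence of one semistable globally-minimal elliptic curve.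
Conversely the datum has no other freedom: `uniformize_eq_of_lattice_eq` (the uniformiser is pinned by the lattice,
`℘[L]` depends on `L.lattice` only), `deg_unique` (the degree is pinned by `φ`; `E(ℂ)` is infinite, `infinite_point`),
`deg_eq_sq_mul_deg` (same newform + same lattice + Manin constants in ratio `k` ⇒ degrees in ratio exactly `k²`).
Reusable by every ABC crux stated with `∃ D : ModularParametrizationData` (FreyDegreeBound, XiBound, …).
-/

noncomputable section

namespace Summit.ABC.ABC.Theorems.DegreePrimesPolyBounded.Negative

open scoped MatrixGroups
open Literature.NumberTheory.EllipticCurves.ModularForms CongruenceSubgroup UpperHalfPlane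

variable {W : WeierstrassCurve ℚ} {N : ℕ} [NeZero N] (D : ModularParametrizationData W N)

/-- The set of `Γ₀(N)`-orbits having a lift `τ` with `φ_D(τ) = P`. [folklore] -/
def fib (P : (W.baseChange ℂ).toAffine.Point) : Set (Y0 N) :=
  {y | ∃ τ : ℍ, Y0.mk N τ = y ∧ D.φ τ = P}

/-- The exceptional set of `deg_spec`, restated with `fib` and `Set.ncard` (definitionally equal). [folklore] -/
theorem finite_setOf_ncard_fib_ne : {P | (fib D P).ncard ≠ D.deg}.Finite := D.deg_spec

/-- Two points of `ℂ` have the same image in `E(ℂ)` iff they differ by a period. [folklore] -/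
theorem uniformize_eq_iff (a b : ℂ) : D.uniformize a = D.uniformize b ↔ a - b ∈ D.L.lattice := by
  rw [← sub_eq_zero, ← map_sub, D.uniformize_eq_zero_iff]

/-- `(m ω₁ + n ω₂)/k ∈ Λ ↔ k ∣ m ∧ k ∣ n`. [folklore] -/
theorem div_mem_lattice_iff (L : PeriodPair) (m n : ℤ) {k : ℕ} (hk : k ≠ 0) :
    ((m : ℂ) * L.ω₁ + (n : ℂ) * L.ω₂) / (k : ℂ) ∈ L.lattice ↔ (k : ℤ) ∣ m ∧ (k : ℤ) ∣ n := by
  have hk' : (k : ℤ) ≠ 0 := by exact_mod_cast hk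
  have h := @PeriodPair.mul_ω₁_add_mul_ω₂_mem_lattice L ((m : ℚ) / ((k : ℤ) : ℚ)) ((n : ℚ) / ((k : ℤ) : ℚ))
  rw [Rat.den_div_intCast_eq_one_iff _ _ hk', Rat.den_div_intCast_eq_one_iff _ _ hk'] at h
  rw [← h]
  push_cast
  ring_nf

/-- The `k²` translates `u((z₀ + i ω₁ + j ω₂)/k)`, `0 ≤ i, j < k`. [folklore] -/
def tors (z₀ : ℂ) (k : ℕ) (x : Fin k × Fin k) : (W.baseChange ℂ).toAffine.Point :=
  D.uniformize ((z₀ + ((x.1 : ℕ) : ℂ) * D.L.ω₁ + ((x.2 : ℕ) : ℂ) * D.L.ω₂) / (k : ℂ))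

/-- Integer combinations of the periods uniformise to `O`. [folklore] -/
theorem uniformize_intComb (m n : ℤ) : D.uniformize ((m : ℂ) * D.L.ω₁ + (n : ℂ) * D.L.ω₂) = 0 :=
  (D.uniformize_eq_zero_iff _).mpr (PeriodPair.mem_lattice.mpr ⟨m, n, rfl⟩)

/-- Each translate is a `k`-th root of `u z₀`: `k • u((z₀ + iω₁ + jω₂)/k) = u z₀`. [folklore] -/
theorem smul_tors (z₀ : ℂ) {k : ℕ} (hk : k ≠ 0) (x : Fin k × Fin k) :
    k • tors D z₀ k x = D.uniformize z₀ := by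
  unfold tors
  rw [← map_nsmul, nsmul_eq_mul, mul_div_cancel₀ _ (Nat.cast_ne_zero.mpr hk), add_assoc, map_add]
  have := uniformize_intComb D (x.1 : ℕ) (x.2 : ℕ)
  push_cast at this
  rw [this, add_zero]

/-- The `k²` translates are pairwise distinct (`(iω₁ + jω₂)/k ∈ Λ ⇒ k ∣ i, j`). [folklore] -/
theorem tors_injective (z₀ : ℂ) {k : ℕ} (hk : k ≠ 0) : Function.Injective (tors D z₀ k) := by
  intro x x' h
  unfold tors at h
  rw [uniformize_eq_iff] at h
  have key : (((((x.1 : ℕ) : ℤ) - ((x'.1 : ℕ) : ℤ) : ℤ) : ℂ) * D.L.ω₁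
      + ((((x.2 : ℕ) : ℤ) - ((x'.2 : ℕ) : ℤ) : ℤ) : ℂ) * D.L.ω₂) / (k : ℂ) ∈ D.L.lattice := by
    convert h using 1
    push_cast
    ring
  rw [div_mem_lattice_iff _ _ _ hk] at key
  obtain ⟨h1, h2⟩ := key
  have e1 : (x'.1 : ℕ) = (x.1 : ℕ) :=
    Nat.ModEq.eq_of_lt_of_lt (Nat.modEq_iff_dvd.mpr h1) x'.1.isLt x.1.isLt
  have e2 : (x'.2 : ℕ) = (x.2 : ℕ) :=
    Nat.ModEq.eq_of_lt_of_lt (Nat.modEq_iff_dvd.mpr h2) x'.2.isLt x.2.isLt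
  exact Prod.ext (Fin.ext e1.symm) (Fin.ext e2.symm)

/-- Every `Q` with `k • Q = u z₀` is one of the `k²` translates. [folklore] -/
theorem exists_tors_eq (z₀ : ℂ) {k : ℕ} (hk : k ≠ 0) {Q : (W.baseChange ℂ).toAffine.Point}
    (hQ : k • Q = D.uniformize z₀) : ∃ x, tors D z₀ k x = Q := by
  obtain ⟨w, rfl⟩ := D.uniformize_surjective Q
  rw [← map_nsmul, nsmul_eq_mul, uniformize_eq_iff] at hQ
  obtain ⟨m, n, hmn⟩ := PeriodPair.mem_lattice.mp hQ
  have hk' : (0 : ℤ) < k := by exact_mod_cast Nat.pos_of_ne_zero hk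
  have hi0 : 0 ≤ m % k := Int.emod_nonneg _ hk'.ne'
  have hj0 : 0 ≤ n % k := Int.emod_nonneg _ hk'.ne'
  have hi : (m % k).toNat < k := by
    have := Int.emod_lt_of_pos m hk'
    omega
  have hj : (n % k).toNat < k := by
    have := Int.emod_lt_of_pos n hk'
    omega
  refine ⟨(⟨(m % k).toNat, hi⟩, ⟨(n % k).toNat, hj⟩), ?_⟩
  unfold tors
  rw [uniformize_eq_iff]
  refine PeriodPair.mem_lattice.mpr ⟨-(m / k), -(n / k), ?_⟩
  have ei : (((m % k).toNat : ℕ) : ℂ) = (m : ℂ) - (k : ℂ) * ((m / k : ℤ) : ℂ) := by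
    have h1 : (((m % k).toNat : ℕ) : ℤ) = m % k := Int.toNat_of_nonneg hi0
    have h2 : m % k = m - k * (m / k) := Int.emod_def m k
    have : (((m % k).toNat : ℕ) : ℂ) = (((((m % k).toNat : ℕ) : ℤ)) : ℂ) := by push_cast; rfl
    rw [this, h1, h2]; push_cast; ring
  have ej : (((n % k).toNat : ℕ) : ℂ) = (n : ℂ) - (k : ℂ) * ((n / k : ℤ) : ℂ) := by
    have h1 : (((n % k).toNat : ℕ) : ℤ) = n % k := Int.toNat_of_nonneg hj0
    have h2 : n % k = n - k * (n / k) := Int.emod_def n k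
    have : (((n % k).toNat : ℕ) : ℂ) = (((((n % k).toNat : ℕ) : ℤ)) : ℂ) := by push_cast; rfl
    rw [this, h1, h2]; push_cast; ring
  have hkC : (k : ℂ) ≠ 0 := Nat.cast_ne_zero.mpr hk
  have hw : (k : ℂ) * w = z₀ + (m : ℂ) * D.L.ω₁ + (n : ℂ) * D.L.ω₂ := by linear_combination -hmn
  rw [ei, ej, eq_sub_iff_add_eq, eq_div_iff hkC]
  push_cast
  linear_combination hw

/-- `{Q | k • Q = u z₀}` is exactly the range of `tors`. [folklore] -/
theorem setOf_smul_eq_eq_range (z₀ : ℂ) {k : ℕ} (hk : k ≠ 0) :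
    {Q : (W.baseChange ℂ).toAffine.Point | k • Q = D.uniformize z₀} = Set.range (tors D z₀ k) := by
  ext Q
  constructor
  · intro hQ
    obtain ⟨x, hx⟩ := exists_tors_eq D z₀ hk hQ
    exact ⟨x, hx⟩
  · rintro ⟨x, rfl⟩
    exact smul_tors D z₀ hk x

/-- The fibre of `k • φ` over `u z₀` is the union of the fibres of `φ` over the translates. [folklore] -/
theorem setOf_fibre_smul_eq (z₀ : ℂ) {k : ℕ} (hk : k ≠ 0) :
    {y : Y0 N | ∃ τ : ℍ, Y0.mk N τ = y ∧ k • D.φ τ = D.uniformize z₀}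
      = ⋃ x : Fin k × Fin k, fib D (tors D z₀ k x) := by
  ext y
  simp only [Set.mem_setOf_eq, Set.mem_iUnion, fib]
  constructor
  · rintro ⟨τ, hy, hτ⟩
    obtain ⟨x, hx⟩ := exists_tors_eq D z₀ hk hτ
    exact ⟨x, τ, hy, hx.symm⟩
  · rintro ⟨x, τ, hy, hτ⟩
    exact ⟨τ, hy, by rw [hτ, smul_tors D z₀ hk x]⟩

/-- Under `Γ₀(N)`-invariance of `φ`, fibres over distinct points are disjoint. [folklore] -/
theorem pairwise_disjoint_fib_tors (hinv : D.φ_gamma0_smul) (z₀ : ℂ) {k : ℕ} (hk : k ≠ 0) :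
    Pairwise (Function.onFun Disjoint fun x : Fin k × Fin k ↦ fib D (tors D z₀ k x)) := by
  intro x x' hne
  rw [Function.onFun, Set.disjoint_left]
  rintro y ⟨τ, hy, hτ⟩ ⟨τ', hy', hτ'⟩
  obtain ⟨γ, rfl⟩ := (Y0.mk_eq_mk_iff N τ τ').mp (hy.trans hy'.symm)
  exact hne (tors_injective D z₀ hk (hτ.symm.trans ((hinv γ τ').trans hτ')))

/-- The fibre count of the pumped map: `k² · deg` wherever all `k²` translates are good. [folklore] -/
theorem ncard_fibre_smul (hinv : D.φ_gamma0_smul) (z₀ : ℂ) {k : ℕ} (hk : k ≠ 0)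
    (hgood : ∀ x : Fin k × Fin k, (fib D (tors D z₀ k x)).ncard = D.deg) :
    {y : Y0 N | ∃ τ : ℍ, Y0.mk N τ = y ∧ k • D.φ τ = D.uniformize z₀}.ncard = k ^ 2 * D.deg := by
  rw [setOf_fibre_smul_eq D z₀ hk,
    Set.ncard_iUnion_of_finite (fun x ↦ Set.finite_of_ncard_pos ((hgood x).symm ▸ D.deg_pos))
      (pairwise_disjoint_fib_tors D hinv z₀ hk)]
  simp only [hgood]
  rw [finsum_eq_sum_of_fintype, Finset.sum_const, Finset.card_univ, Fintype.card_prod,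
    Fintype.card_fin, smul_eq_mul, sq]

/-- **Pumping the Manin constant.** From a datum `D` and `k ≥ 1`: the datum with the same newform,
lattice and uniformisation, Manin constant `k c` and degree `k² deg` (`φ' = [k] ∘ φ`). The field
`deg_spec` of the new datum needs the `Γ₀(N)`-invariance of `φ_D` (`D.φ_gamma0_smul`, which holds
given the C9 fact `eichlerIntegral_gamma_smul D.f`, `φ_gamma0_smul_holds`). [folklore] -/
def pump (k : ℕ) (hk : k ≠ 0) (hinv : D.φ_gamma0_smul) : ModularParametrizationData W N where
  f := D.f
  isNewformOf := D.isNewformOf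
  L := D.L
  isNeronLattice := D.isNeronLattice
  uniformize := D.uniformize
  ker_uniformize := D.ker_uniformize
  uniformize_surjective := D.uniformize_surjective
  uniformize_spec := D.uniformize_spec
  c := k * D.c
  smul_periodLattice_le z hz := by
    have h := D.smul_periodLattice_le z hz
    have : (((k : ℤ) * D.c : ℤ) : ℂ) * z = (k : ℤ) • ((D.c : ℂ) * z) := by push_cast; rw [zsmul_eq_mul]; push_cast; ring
    rw [this]
    exact D.L.lattice.smul_mem (k : ℤ) h
  deg := k ^ 2 * D.deg
  deg_pos := Nat.mul_pos (pow_pos (Nat.pos_of_ne_zero hk) 2) D.deg_pos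
  deg_spec := by
    have hbad := (finite_setOf_ncard_fib_ne D).image fun Q ↦ k • Q
    refine hbad.subset fun P hP ↦ ?_
    by_contra hP'
    apply hP
    obtain ⟨z₀, rfl⟩ := D.uniformize_surjective P
    have hgood : ∀ x : Fin k × Fin k, (fib D (tors D z₀ k x)).ncard = D.deg := by
      intro x
      by_contra hx
      exact hP' ⟨tors D z₀ k x, hx, smul_tors D z₀ hk x⟩
    have h := ncard_fibre_smul D hinv z₀ hk hgood
    rw [← Nat.card_coe_set_eq] at h
    have e : ∀ τ : ℍ, D.uniformize ((((k : ℤ) * D.c : ℤ) : ℂ) * eichlerIntegral D.f τ) = k • D.φ τ := by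
      intro τ
      show D.uniformize _ = k • D.uniformize _
      rw [← map_nsmul, nsmul_eq_mul]
      congr 1
      push_cast
      ring
    show Nat.card {y : Y0 N // ∃ τ : ℍ, Y0.mk N τ = y ∧
      D.uniformize ((((k : ℤ) * D.c : ℤ) : ℂ) * eichlerIntegral D.f τ) = D.uniformize z₀} = k ^ 2 * D.deg
    simp_rw [e]
    exact h

/-- The pumped datum has degree `k² · deg`. [folklore] -/
theorem pump_deg (k : ℕ) (hk : k ≠ 0) (hinv : D.φ_gamma0_smul) :
    (pump D k hk hinv).modularDegree = k ^ 2 * D.modularDegree := rfl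

/-- The pumped datum has Manin constant `k · c`. [folklore] -/
theorem pump_maninConstant (k : ℕ) (hk : k ≠ 0) (hinv : D.φ_gamma0_smul) :
    (pump D k hk hinv).maninConstant = k * D.maninConstant := rfl


/-- `℘` depends on the period pair only through its lattice. [folklore] -/
theorem weierstrassP_congr {L L' : PeriodPair} (h : L.lattice = L'.lattice) (z : ℂ) :
    L.weierstrassP z = L'.weierstrassP z := by
  unfold PeriodPair.weierstrassP
  exact congrArg (fun S : Submodule ℤ ℂ ↦ ∑' l : S, (1 / (z - (l : ℂ)) ^ 2 - 1 / (l : ℂ) ^ 2)) h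

/-- `℘'` depends on the period pair only through its lattice. [folklore] -/
theorem derivWeierstrassP_congr {L L' : PeriodPair} (h : L.lattice = L'.lattice) (z : ℂ) :
    L.derivWeierstrassP z = L'.derivWeierstrassP z := by
  unfold PeriodPair.derivWeierstrassP
  exact congrArg (fun S : Submodule ℤ ℂ ↦ - ∑' l : S, 2 / (z - (l : ℂ)) ^ 3) h

/-- **The uniformisation is pinned by the lattice**: two data of the same model with the same Néron lattice
have the same `uniformize` (both vanish on `Λ` and are the `℘`-map off `Λ`). [folklore] -/
theorem uniformize_eq_of_lattice_eq (D D' : ModularParametrizationData W N) (hL : D'.L.lattice = D.L.lattice) :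
    D'.uniformize = D.uniformize := by
  ext1 z
  by_cases hz : z ∈ D.L.lattice
  · rw [(D.uniformize_eq_zero_iff z).mpr hz, (D'.uniformize_eq_zero_iff z).mpr (hL ▸ hz)]
  · obtain ⟨h, e⟩ := D.uniformize_spec z hz
    obtain ⟨h', e'⟩ := D'.uniformize_spec z (hL ▸ hz)
    rw [e, e', WeierstrassCurve.Affine.Point.some.injEq]
    simp only [weierstrassP_congr hL, derivWeierstrassP_congr hL, and_self]

/-- `E(ℂ)` is infinite: it contains `k²` distinct `k`-division points of any point, for every `k`. [folklore] -/
theorem infinite_point (D : ModularParametrizationData W N) : Infinite (W.baseChange ℂ).toAffine.Point := by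
  refine Infinite.of_not_fintype fun hfin ↦ ?_
  set n := Fintype.card (W.baseChange ℂ).toAffine.Point
  have hinj := tors_injective D 0 (Nat.succ_ne_zero n)
  have := Fintype.card_le_of_injective _ hinj
  simp only [Fintype.card_prod, Fintype.card_fin] at this
  nlinarith

/-- The degree of a datum is determined by its parametrisation: the cofinite fibre count is unique. [folklore] -/
theorem deg_unique (D : ModularParametrizationData W N) {d : ℕ}
    (hd : {P : (W.baseChange ℂ).toAffine.Point |
      Nat.card {y : Y0 N // ∃ τ : ℍ, Y0.mk N τ = y ∧ D.φ τ = P} ≠ d}.Finite) : d = D.deg := by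
  by_contra hne
  haveI := infinite_point D
  have hfin : (Set.univ : Set (W.baseChange ℂ).toAffine.Point).Finite := by
    refine (hd.union D.deg_spec).subset fun P _ ↦ ?_
    by_cases hP : Nat.card {y : Y0 N // ∃ τ : ℍ, Y0.mk N τ = y ∧ D.φ τ = P} = d
    · right
      show Nat.card {y : Y0 N // ∃ τ : ℍ, Y0.mk N τ = y ∧ D.φ τ = P} ≠ D.deg
      rw [hP]; exact hne
    · left; exact hP
  exact Set.infinite_univ hfin

/-- **Degrees scale with the square of the Manin constant.** Two data of the same model with the same newform
and the same Néron lattice whose Manin constants differ by the factor `k` have degrees differing by `k²`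
(given the `Γ₀(N)`-invariance of `φ_D`). With `pump` this pins the degree set of `(W, f, Λ)` to
`{(c/g)² · d_g}` over the admissible constants `c ∈ gℤ`: the `∃ D` of the crux cannot cheat — every datum's
degree is a square multiple of the least one, so its prime support contains that of the least one. [folklore] -/
theorem deg_eq_sq_mul_deg (D D' : ModularParametrizationData W N) (hinv : D.φ_gamma0_smul)
    (hf : D'.f = D.f) (hL : D'.L.lattice = D.L.lattice) {k : ℕ} (hk : k ≠ 0) (hc : D'.c = k * D.c) :
    D'.deg = k ^ 2 * D.deg := by
  have hu := uniformize_eq_of_lattice_eq D D' hL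
  have hφ : ∀ τ, D'.φ τ = (pump D k hk hinv).φ τ := by
    intro τ
    show D'.uniformize ((D'.c : ℂ) * eichlerIntegral D'.f τ) =
      D.uniformize ((((k : ℤ) * D.c : ℤ) : ℂ) * eichlerIntegral D.f τ)
    rw [hu, hf, hc]
  have h := (pump D k hk hinv).deg_spec
  refine (deg_unique D' (d := k ^ 2 * D.deg) ?_).symm
  convert h using 4 with P <;> first | rfl | (simp only [hφ]; rfl)


/-- **The `∀ D` form of the crux is false** as soon as ONE semistable globally-minimal elliptic curve carries ONE
datum with `Γ₀(N)`-invariant `φ`: pump its Manin constant by a prime `p > C · N^κ`; then `p ∣ p² · deg`.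
[folklore] -/
theorem not_forall_datum_primes_bounded_of (W₀ : WeierstrassCurve ℚ) [W₀.IsElliptic] [W₀.IsGloballyMinimal]
    [NeZero (W₀.conductorNorm ℤ)] (hW₀ : W₀.IsSemistable ℤ)
    (D₀ : ModularParametrizationData W₀ (W₀.conductorNorm ℤ)) (hinv : D₀.φ_gamma0_smul) :
    ¬ ∃ κ C : ℝ, ∀ (W : WeierstrassCurve ℚ) [W.IsElliptic] [W.IsGloballyMinimal] [NeZero (W.conductorNorm ℤ)],
        W.IsSemistable ℤ → ∀ D : ModularParametrizationData W (W.conductorNorm ℤ),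
          ∀ ℓ : ℕ, ℓ.Prime → ℓ ∣ D.modularDegree → (ℓ : ℝ) ≤ C * (W.conductorNorm ℤ : ℝ) ^ κ := by
  rintro ⟨κ, C, h⟩
  obtain ⟨p, hp_ge, hp⟩ := Nat.exists_infinite_primes (⌈C * (W₀.conductorNorm ℤ : ℝ) ^ κ⌉₊ + 1)
  have hle := h W₀ hW₀ (pump D₀ p hp.ne_zero hinv) p hp ⟨p * D₀.modularDegree, by rw [pump_deg]; ring⟩
  have hlt : C * (W₀.conductorNorm ℤ : ℝ) ^ κ < p :=
    calc C * (W₀.conductorNorm ℤ : ℝ) ^ κ ≤ ⌈C * (W₀.conductorNorm ℤ : ℝ) ^ κ⌉₊ := Nat.le_ceil _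
      _ < ((⌈C * (W₀.conductorNorm ℤ : ℝ) ^ κ⌉₊ + 1 : ℕ) : ℝ) := by push_cast; linarith
      _ ≤ p := by exact_mod_cast hp_ge
  linarith

/-- The same over the tree's named facts: datum existence (`nonempty_modularParametrizationData`, BCDT 2001 +
Edixhoven 1991), `Γ₀(N)`-invariance of Eichler integrals modulo periods (`eichlerIntegral_gamma_smul`, Manin 1972),
and one semistable globally-minimal elliptic curve over `ℚ`. [folklore] -/
theorem not_forall_datum_primes_bounded_of_facts (hmod : nonempty_modularParametrizationData)
    (hES : ∀ (M : ℕ) (g : CuspForm (Gamma0 M) 2), eichlerIntegral_gamma_smul g)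
    (hex : ∃ (W₀ : WeierstrassCurve ℚ) (_ : W₀.IsElliptic) (_ : W₀.IsGloballyMinimal), W₀.IsSemistable ℤ) :
    ¬ ∃ κ C : ℝ, ∀ (W : WeierstrassCurve ℚ) [W.IsElliptic] [W.IsGloballyMinimal] [NeZero (W.conductorNorm ℤ)],
        W.IsSemistable ℤ → ∀ D : ModularParametrizationData W (W.conductorNorm ℤ),
          ∀ ℓ : ℕ, ℓ.Prime → ℓ ∣ D.modularDegree → (ℓ : ℝ) ≤ C * (W.conductorNorm ℤ : ℝ) ^ κ := by
  obtain ⟨W₀, _, _, hW₀⟩ := hex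
  haveI : NeZero (W₀.conductorNorm ℤ) := ⟨(WeierstrassCurve.conductorNorm_pos_holds W₀).ne'⟩
  obtain ⟨D₀⟩ := hmod W₀
  exact not_forall_datum_primes_bounded_of W₀ hW₀ D₀ (D₀.φ_gamma0_smul_holds (hES _ D₀.f))

end Summit.ABC.ABC.Theorems.DegreePrimesPolyBounded.Negative
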